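import Literature.NumberTheory.Automorphic.LocalEndoscopicOrbitClosed   -- ★ `gl_fin_one_comm`, `conj_eq_self_fin_one` (`U(J₁) ≤ GL₁` is commutative); brings ★ `LocalOrbitalIntegral` (`orbitalIntegral`, `orbitalIntegral_eq_integral_descConj`, `classOrbitalIntegral`), ★ `descConj(_mk)`, `cmDatum`
import Literature.MeasureTheory.Group.InvariantQuotientOrbitalProd       -- ★ `centralizer_singleton_prod_eq` (`C((a, b)) = C(a) × C(b)`)
import HarnessLib

/-!
# R90 · S6 «Ch. 14.1–14.5 stable trace formula» — CARD U1B (DAG row E1.3.7.2): THE COMPACT-FACTOR DROP ON THE ORBITAL SIDE,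
# `O_{(γ₁, γ₂)}(f₁ ⊗ 1) = O_{γ₁}(f₁)` for `γ₂` central in `G₂` (`Theorems/R90S6CompactFactorOrbitalDrop.lean`)

Dealer R90-C14-plan (g2), CARD U1B 2026-09-05T02:38:44Z: «DAG row E1.3.7.2: the (H_w = U(2)×U(1), C = U(1)³) COMPACT-FACTOR DROP on the ORBITAL side
(the Hecke side is ★ W7-c `tensorHeckeAlgebraAlgEquivOfEqTop(_tmul)`, `Theorems/R90S6HeckeAlgebraTop.lean` — cited, not redone): generic frame
`G₁ G₂` groups, `γ₂ ∈ Subgroup.center G₂` (U(1) abelian ⇒ automatic), `f = f₁ ∘ Prod.fst` (φ₂ ⊗ 1)».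

THE MATHEMATICS [Rogawski1990 L. 4.9.3 p. 56, §4.8 Case (a) p. 53; Gelbart1975 (9.13), (10.19)].  For groups `G₁`, `G₂` and `γ ∈ G₁ × G₂` with `γ.2`
CENTRAL in `G₂` (e.g. `G₂ = U(1)_w` abelian): `C_{G₁×G₂}(γ) = C_{G₁}(γ.1) × G₂` (§1), so `x C(γ.1) ↦ (x, 1) C(γ)` is a bijection
`e : G₁ ⧸ C(γ.1) ≃ (G₁ × G₂) ⧸ C(γ)` with inverse `p C(γ) ↦ p.1 C(γ.1)` — a homeomorphism of the coset spaces, a measurable equivalence of their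
Borel spaces (§2, as `∃`-theorems carrying the two defining equations; no definition) — and the orbital integrand `y C(γ) ↦ f(y γ y⁻¹)` of
`f = f₁ ∘ Prod.fst` (`= f₁ ⊗ 1`) is the pull-back along `e⁻¹` of `x C(γ.1) ↦ f₁(x γ.1 x⁻¹)` (§3).  The measure on the orbit space being a
PARAMETER of ★ `orbitalIntegral` (no normalisation chosen), the drop is the change of variables along `e` (★ `integral_map_equiv`, no
integrability hypothesis): **`O_γ^{e_* m₁}(f₁ ∘ fst) = O_{γ.1}^{m₁}(f₁)`** (§3 HEAD), equivalently `O_γ^{μ}(f₁ ∘ fst) = O_{γ.1}^{(e⁻¹)_* μ}(f₁)` for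
every `μ` on `(G₁ × G₂) ⧸ C(γ)`; for a complex `Φ = ξ ⊗ χ` (`Φ(a, k) = ξ(a) χ(k)`), `O_γ^{e_* m₁}(Φ) = O_{γ.1}^{m₁}(ξ) · χ(γ.2)` (the
`U(1)`-character bookkeeping of L. 4.9.3).  §4: `e` is equivariant, so invariant measures correspond to invariant measures both ways.  §5: the
editions for `G₂ = U(J₁) ≤ GL₁(S)` (★ `conj_eq_self_fin_one`: every element is central) and for the CM local carrier
`H_v = U(Φ₂)(L⁺_v) × U(Φ₁)(L⁺_v)` of the S6 floor socket `StubR90ExtE1HeckeFL`, whose H-side test function is literally `fun h => F (eH h.1)`,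
an `f₁ ∘ Prod.fst`; and the `classOrbitalIntegral` form a consumer holding `mH : OrbitalMeasureFamily H_v` meets.
STATEMENT SHAPE: every theorem is stated for a general `γ : G₁ × G₂` through `γ.1`, `γ.2` (tree precedent ★ `setOf_conj_prod_eq`), so it applies
verbatim to representatives `Quotient.out c` and by `rfl` to literal pairs; σ-algebras on the two orbit spaces are typeclass binders (arbitrary in
§3, Borel in §2 ∕ §4); the bijection enters §3–§4 as a letter `e` with its defining equation `he : ∀ x, e (x C(γ.1)) = (x, 1) C(γ)` (resp. `hes`
for `e.symm`), discharged by §2 ∕ §5.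

* §1 (U1B.1) `centralizer_prod_singleton_of_mem_center` (`C(γ) = C(γ.1).prod ⊤`), `mem_centralizer_prod_singleton_iff_of_mem_center`,
  `conj_prod_eq_of_mem_center`, `leftRel_prod_of_leftRel_fst`, `leftRel_fst_of_leftRel_prod`,
  `mk_fst_one_eq_mk_of_mem_center`.
* §2 (U1B.2) `exists_homeomorph_quotient_centralizer_prod_of_mem_center`, `exists_measurableEquiv_quotient_centralizer_prod_of_mem_center`.
* §3 (U1B.2 compat, U1B.3) `descConj_prod_comp_fst_apply_eq`, `descConj_prod_comp_fst_eq_apply`,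
  `descConj_prod_tensor_apply_eq_of_mem_center`; **`orbitalIntegral_prod_comp_fst_map_eq`** (HEAD), **`orbitalIntegral_prod_comp_fst_eq_map_symm`**,
  `orbitalIntegral_prod_tensor_map_eq_of_mem_center`.
* §4 `apply_smul_eq_smul_apply_of_mem_center`, `symm_apply_smul_eq_smul_symm_apply`, `smulInvariantMeasure_map_prod_centralizer_of_mem_center`,
  `smulInvariantMeasure_map_symm_prod_centralizer`.
* §5 (U1B.4) `mem_center_unitaryGroupOfForm_fin_one`, `exists_measurableEquiv_quotient_centralizer_unitary_fin_one`,
  `mem_center_cmLocal_one`, `exists_measurableEquiv_quotient_centralizer_cmLocalH`, `classOrbitalIntegral_comp_fst_eq_orbitalIntegral_map_symm`.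

Cell `hodgecm-mathlib`, crux H413 (`stmt-HodgeConjecture-24833`), route of record `HCCMUnconditional`; programme R90-TF (brief `director/R90-BRIEF.v2.md`
1f40d54518340a35), section S6 (base `R90-C14`), seat R90-C14-p01 (g3).  Lane `--kind proof --supports stmt-HodgeConjecture-24833 --as helper`; THEOREMS
ONLY (no definition, no instance, no notation, no named fact, no kit, no `sorry`); imports ★ `LocalEndoscopicOrbitClosed` + ★ `InvariantQuotientOrbitalProd`
+ HarnessLib; never `Lines/`.  HONEST LABEL: measure-theoretic plumbing on orbit spaces, count-neutral until the E1.3.7.2 consumer (H-side export ∕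
floor-socket assembly E1.3.9) uses it; proves no printed global statement, discharges no citation; HC_CM is proved only modulo the 7 printed citations
(2 remaining named inputs: hLiu418 = stmt-HodgeConjecture-24832, h413 = stmt-HodgeConjecture-24833) until rung 0 closes.

## Tree search
★ `InvariantQuotientOrbitalProd` (`centralizer_singleton_prod_eq`; `exists_integral_descConj_eq_smul_mul` = two-factor factorisation with an unnamed
`c ≠ 0` and non-zero invariant measures on BOTH factors — not the constant-free drop of a central factor); ★ `InvariantQuotientPiTopFactor(Map)` (the
`(Π_i G_i) × B`, `B ⊆ M` package for the canonical ★ `quotientMeasure`, Haar data required — archimedean LH3 shape; this file is the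
measure-as-parameter form); ★ `LocalEndoscopicOrbitClosed` §1 (`setOf_conj_prod_eq`: the CLASS of `(a, b)` is `class(a) ×ˢ {b}`, the set-level
shadow of §1); Mathlib `Subgroup.centralizer_eq_top_iff_subset`, `QuotientGroup.leftRel_apply`, `integral_map_equiv`, `MeasurableEquiv.map_map_symm`.
Dedup: `rg` of every declared name over `lean/Literature lean/Summits` — no hit (the Literature lemma `smulInvariantMeasure_map_symm_prod` is a
different statement; names here carry `_centralizer`).

## References
* [Rogawski1990] J. D. Rogawski, *Automorphic Representations of Unitary Groups in Three Variables*, Ann. of Math. Stud. 123 (1990): L. 4.9.3 p. 56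
  (the `(H, C)` clause, `C = U(1)³` compact), §4.8 Case (a) p. 53, §4.9 p. 54 (`Φ(γ, f)`).
* [Gelbart1975] S. Gelbart, *Automorphic forms on adele groups*, Ann. of Math. Stud. 83 (1975), (9.13) p. 154, (10.19) p. 155.
* [Folland1995] G. B. Folland, *A Course in Abstract Harmonic Analysis* (1995), §2.6 (invariant measures on coset spaces).
-/

set_option autoImplicit false
-- the mandated namespace repeats the single-problem summit's segment (`HodgeConjecture.HodgeConjecture`)
set_option linter.dupNamespace false

noncomputable section

open MeasureTheory Measure Set Function Filter
open Literature.MeasureTheory.Group Literature.NumberTheory.Automorphic Literature.NumberTheory.Rogawski1990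

namespace Summit.HodgeConjecture.HodgeConjecture.R90.S6

/-! ## §1 The centraliser of `γ = (γ₁, γ₂)` with `γ₂` central: `C(γ) = C(γ₁) × G₂` -/

section Algebra

variable {G₁ G₂ : Type*} [Group G₁] [Group G₂]

/-- **(U1B.1)** For `γ ∈ G₁ × G₂` with `γ.2` central in `G₂`, `C_{G₁×G₂}(γ) = C_{G₁}(γ.1) × G₂` (★ `centralizer_singleton_prod_eq` and
`C(γ.2) = ⊤`). [cite: Rogawski1990, §4.8 Case (a) p. 53] -/
theorem centralizer_prod_singleton_of_mem_center (γ : G₁ × G₂) (hγ : γ.2 ∈ Subgroup.center G₂) :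
    Subgroup.centralizer ({γ} : Set (G₁ × G₂)) = (Subgroup.centralizer ({γ.1} : Set G₁)).prod ⊤ := by
  rw [← Subgroup.centralizer_eq_top_iff_subset.2 (Set.singleton_subset_iff.2 hγ), ← centralizer_singleton_prod_eq]

/-- Membership in `C(γ)` for `γ.2` central: `p ∈ C(γ) ↔ p.1 ∈ C(γ.1)`. [cite: Rogawski1990, §4.8 Case (a) p. 53] -/
theorem mem_centralizer_prod_singleton_iff_of_mem_center (γ : G₁ × G₂) (hγ : γ.2 ∈ Subgroup.center G₂) (p : G₁ × G₂) :
    p ∈ Subgroup.centralizer ({γ} : Set (G₁ × G₂)) ↔ p.1 ∈ Subgroup.centralizer ({γ.1} : Set G₁) := by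
  rw [centralizer_prod_singleton_of_mem_center γ hγ, Subgroup.mem_prod]
  simp only [Subgroup.mem_top, and_true]

/-- Conjugates of `γ` with `γ.2` central: `y γ y⁻¹ = (y.1 γ.1 y.1⁻¹, γ.2)`. [cite: Rogawski1990, §4.8 Case (a) p. 53] -/
theorem conj_prod_eq_of_mem_center (γ : G₁ × G₂) (hγ : γ.2 ∈ Subgroup.center G₂) (y : G₁ × G₂) :
    y * γ * y⁻¹ = (y.1 * γ.1 * y.1⁻¹, γ.2) := by
  ext
  · rfl
  · show y.2 * γ.2 * y.2⁻¹ = γ.2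
    rw [Subgroup.mem_center_iff.1 hγ y.2, mul_inv_cancel_right]

/-- `x ↦ (x, 1)` is compatible with the coset relations of `C(γ.1)` and `C(γ)` (no centrality needed). [cite: Gelbart1975, (9.13)] -/
theorem leftRel_prod_of_leftRel_fst (γ : G₁ × G₂) (a b : G₁)
    (hab : QuotientGroup.leftRel (Subgroup.centralizer ({γ.1} : Set G₁)) a b) :
    QuotientGroup.leftRel (Subgroup.centralizer ({γ} : Set (G₁ × G₂))) ((a, 1) : G₁ × G₂) (b, 1) := by
  rw [QuotientGroup.leftRel_apply] at hab ⊢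
  show ((a, (1 : G₂)) : G₁ × G₂)⁻¹ * (b, 1) ∈ Subgroup.centralizer ({(γ.1, γ.2)} : Set (G₁ × G₂))
  rw [centralizer_singleton_prod_eq, Subgroup.mem_prod]
  refine ⟨?_, ?_⟩
  · simpa using hab
  · simp only [Prod.inv_mk, Prod.mk_mul_mk, inv_one, mul_one]
    exact Subgroup.one_mem _

/-- `Prod.fst` is compatible with the coset relations of `C(γ)` and `C(γ.1)` (no centrality needed). [cite: Gelbart1975, (9.13)] -/
theorem leftRel_fst_of_leftRel_prod (γ : G₁ × G₂) (p q : G₁ × G₂)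
    (hpq : QuotientGroup.leftRel (Subgroup.centralizer ({γ} : Set (G₁ × G₂))) p q) :
    QuotientGroup.leftRel (Subgroup.centralizer ({γ.1} : Set G₁)) p.1 q.1 := by
  rw [QuotientGroup.leftRel_apply] at hpq ⊢
  have hpq' : p⁻¹ * q ∈ Subgroup.centralizer ({(γ.1, γ.2)} : Set (G₁ × G₂)) := hpq
  rw [centralizer_singleton_prod_eq] at hpq'
  exact (Subgroup.mem_prod.1 hpq').1

/-- For `γ.2` central, `(p.1, 1) C(γ) = p C(γ)` for every `p`. [cite: Rogawski1990, §4.8 Case (a) p. 53] -/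
theorem mk_fst_one_eq_mk_of_mem_center (γ : G₁ × G₂) (hγ : γ.2 ∈ Subgroup.center G₂) (p : G₁ × G₂) :
    (QuotientGroup.mk ((p.1, 1) : G₁ × G₂) : (G₁ × G₂) ⧸ Subgroup.centralizer ({γ} : Set (G₁ × G₂))) = QuotientGroup.mk p := by
  rw [QuotientGroup.eq, mem_centralizer_prod_singleton_iff_of_mem_center γ hγ]
  simp only [Prod.inv_mk, Prod.fst_mul, inv_mul_cancel]
  exact Subgroup.one_mem _

end Algebra

/-! ## §2 (U1B.2) The bijection `e : G₁ ⧸ C(γ.1) ≃ (G₁ × G₂) ⧸ C(γ)`, `x C(γ.1) ↦ (x, 1) C(γ)` — as a homeomorphism and as a measurable equivalence -/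

section Bijection

variable {G₁ G₂ : Type*} [Group G₁] [Group G₂] [TopologicalSpace G₁] [TopologicalSpace G₂]

/-- **(U1B.2, homeomorphism)** For `γ.2` central (any topologies on `G₁`, `G₂`) there is a homeomorphism of coset spaces
`e : G₁ ⧸ C(γ.1) ≃ₜ (G₁ × G₂) ⧸ C(γ)` with `e(x C(γ.1)) = (x, 1) C(γ)` and `e⁻¹(p C(γ)) = p.1 C(γ.1)` (the two `Quotient.map'`s of the continuous
maps `x ↦ (x, 1)` and `Prod.fst`; `e.toEquiv` is the bare bijection). [cite: Rogawski1990, L. 4.9.3 p. 56] [cite: Folland1995, §2.6] -/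
theorem exists_homeomorph_quotient_centralizer_prod_of_mem_center (γ : G₁ × G₂) (hγ : γ.2 ∈ Subgroup.center G₂) :
    ∃ e : G₁ ⧸ Subgroup.centralizer ({γ.1} : Set G₁) ≃ₜ (G₁ × G₂) ⧸ Subgroup.centralizer ({γ} : Set (G₁ × G₂)),
      (∀ x : G₁, e (QuotientGroup.mk x) = QuotientGroup.mk (x, 1)) ∧
        ∀ p : G₁ × G₂, e.symm (QuotientGroup.mk p) = QuotientGroup.mk p.1 :=
  ⟨{ toFun := Quotient.map' (fun x : G₁ => ((x, 1) : G₁ × G₂)) (leftRel_prod_of_leftRel_fst γ)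
     invFun := Quotient.map' Prod.fst (leftRel_fst_of_leftRel_prod γ)
     left_inv := fun x => QuotientGroup.induction_on x fun _ => rfl
     right_inv := fun y => QuotientGroup.induction_on y fun p => mk_fst_one_eq_mk_of_mem_center γ hγ p
     continuous_toFun := (continuous_id.prodMk continuous_const).quotient_map' _
     continuous_invFun := continuous_fst.quotient_map' _ },
    fun _ => rfl, fun _ => rfl⟩

/-- **(U1B.2, measurable equivalence)** For the Borel σ-algebras of the two coset spaces and `γ.2` central, the bijection is a measurable
equivalence `e : G₁ ⧸ C(γ.1) ≃ᵐ (G₁ × G₂) ⧸ C(γ)` (`Homeomorph.toMeasurableEquiv`). [cite: Rogawski1990, L. 4.9.3 p. 56] [cite: Folland1995, §2.6] -/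
theorem exists_measurableEquiv_quotient_centralizer_prod_of_mem_center (γ : G₁ × G₂) (hγ : γ.2 ∈ Subgroup.center G₂)
    [MeasurableSpace (G₁ ⧸ Subgroup.centralizer ({γ.1} : Set G₁))] [BorelSpace (G₁ ⧸ Subgroup.centralizer ({γ.1} : Set G₁))]
    [MeasurableSpace ((G₁ × G₂) ⧸ Subgroup.centralizer ({γ} : Set (G₁ × G₂)))]
    [BorelSpace ((G₁ × G₂) ⧸ Subgroup.centralizer ({γ} : Set (G₁ × G₂)))] :
    ∃ e : G₁ ⧸ Subgroup.centralizer ({γ.1} : Set G₁) ≃ᵐ (G₁ × G₂) ⧸ Subgroup.centralizer ({γ} : Set (G₁ × G₂)),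
      (∀ x : G₁, e (QuotientGroup.mk x) = QuotientGroup.mk (x, 1)) ∧
        ∀ p : G₁ × G₂, e.symm (QuotientGroup.mk p) = QuotientGroup.mk p.1 := by
  obtain ⟨h, h1, h2⟩ := exists_homeomorph_quotient_centralizer_prod_of_mem_center γ hγ
  refine ⟨h.toMeasurableEquiv, fun x => ?_, fun p => ?_⟩
  · rw [Homeomorph.toMeasurableEquiv_coe, h1]
  · rw [Homeomorph.toMeasurableEquiv_symm_coe, h2]

end Bijection

/-! ## §3 (U1B.3) The orbital integrand of `f₁ ∘ fst` and the HEAD `O_γ^{e_* m₁}(f₁ ∘ fst) = O_{γ.1}^{m₁}(f₁)` -/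

section Orbital

variable {G₁ G₂ : Type*} [Group G₁] [Group G₂] (γ : G₁ × G₂)

/-- **(U1B.2, compatibility along `e`)** For any map `e : G₁ ⧸ C(γ.1) → (G₁ × G₂) ⧸ C(γ)` with `e(x C(γ.1)) = (x, 1) C(γ)`, the orbital
integrand of `f₁ ∘ fst` pulled back along `e` is the orbital integrand of `f₁`:
`descConj γ C(γ) (f₁ ∘ fst) (e x) = descConj γ.1 C(γ.1) f₁ x` (no centrality, no measurability). [cite: Rogawski1990, L. 4.9.3 p. 56] [cite: Gelbart1975, (9.13)] -/
theorem descConj_prod_comp_fst_apply_eq {α : Type*}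
    (e : G₁ ⧸ Subgroup.centralizer ({γ.1} : Set G₁) → (G₁ × G₂) ⧸ Subgroup.centralizer ({γ} : Set (G₁ × G₂)))
    (he : ∀ x : G₁, e (QuotientGroup.mk x) = QuotientGroup.mk (x, 1)) (f₁ : G₁ → α)
    (x : G₁ ⧸ Subgroup.centralizer ({γ.1} : Set G₁)) :
    descConj γ (Subgroup.centralizer ({γ} : Set (G₁ × G₂))) (fun _ hg => Subgroup.mem_centralizer_singleton_iff.1 hg)
        (f₁ ∘ Prod.fst) (e x) =
      descConj γ.1 (Subgroup.centralizer ({γ.1} : Set G₁)) (fun _ hg => Subgroup.mem_centralizer_singleton_iff.1 hg) f₁ x := by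
  induction x using QuotientGroup.induction_on with
  | H a => rw [he]; rfl

/-- **Compatibility along `e⁻¹`**: for any map `π : (G₁ × G₂) ⧸ C(γ) → G₁ ⧸ C(γ.1)` with `π(p C(γ)) = p.1 C(γ.1)`,
`descConj γ C(γ) (f₁ ∘ fst) y = descConj γ.1 C(γ.1) f₁ (π y)` (no centrality, no measurability). [cite: Rogawski1990, L. 4.9.3 p. 56] [cite: Gelbart1975, (9.13)] -/
theorem descConj_prod_comp_fst_eq_apply {α : Type*}
    (π : (G₁ × G₂) ⧸ Subgroup.centralizer ({γ} : Set (G₁ × G₂)) → G₁ ⧸ Subgroup.centralizer ({γ.1} : Set G₁))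
    (hπ : ∀ p : G₁ × G₂, π (QuotientGroup.mk p) = QuotientGroup.mk p.1) (f₁ : G₁ → α)
    (y : (G₁ × G₂) ⧸ Subgroup.centralizer ({γ} : Set (G₁ × G₂))) :
    descConj γ (Subgroup.centralizer ({γ} : Set (G₁ × G₂))) (fun _ hg => Subgroup.mem_centralizer_singleton_iff.1 hg)
        (f₁ ∘ Prod.fst) y =
      descConj γ.1 (Subgroup.centralizer ({γ.1} : Set G₁)) (fun _ hg => Subgroup.mem_centralizer_singleton_iff.1 hg) f₁ (π y) := by
  induction y using QuotientGroup.induction_on with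
  | H p => rw [hπ]; rfl

/-- **The orbital integrand of a factorizable `Φ = ξ ⊗ χ`** (`Φ(a, k) = ξ(a) χ(k)`) for `γ.2` central, along `e`:
`descConj γ C(γ) Φ (e x) = descConj γ.1 C(γ.1) ξ x · χ(γ.2)` (the `G₂`-conjugates of the central `γ.2` are `γ.2`).
[cite: Rogawski1990, L. 4.9.3 p. 56] [cite: Gelbart1975, (10.19)] -/
theorem descConj_prod_tensor_apply_eq_of_mem_center {M : Type*} [Mul M] (hγ : γ.2 ∈ Subgroup.center G₂)
    (e : G₁ ⧸ Subgroup.centralizer ({γ.1} : Set G₁) → (G₁ × G₂) ⧸ Subgroup.centralizer ({γ} : Set (G₁ × G₂)))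
    (he : ∀ x : G₁, e (QuotientGroup.mk x) = QuotientGroup.mk (x, 1)) {Φ : G₁ × G₂ → M} {ξ : G₁ → M} {χ : G₂ → M}
    (hΦ : ∀ a k, Φ (a, k) = ξ a * χ k) (x : G₁ ⧸ Subgroup.centralizer ({γ.1} : Set G₁)) :
    descConj γ (Subgroup.centralizer ({γ} : Set (G₁ × G₂))) (fun _ hg => Subgroup.mem_centralizer_singleton_iff.1 hg) Φ (e x) =
      descConj γ.1 (Subgroup.centralizer ({γ.1} : Set G₁)) (fun _ hg => Subgroup.mem_centralizer_singleton_iff.1 hg) ξ x * χ γ.2 := by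
  induction x using QuotientGroup.induction_on with
  | H a => rw [he, descConj_mk, descConj_mk, conj_prod_eq_of_mem_center γ hγ, hΦ]

variable {E : Type*} [NormedAddCommGroup E] [NormedSpace ℝ E]
  [MeasurableSpace (G₁ ⧸ Subgroup.centralizer ({γ.1} : Set G₁))]
  [MeasurableSpace ((G₁ × G₂) ⧸ Subgroup.centralizer ({γ} : Set (G₁ × G₂)))]

/-- **(U1B.3) HEAD — THE COMPACT-FACTOR DROP ON THE ORBITAL SIDE.**  For `γ ∈ G₁ × G₂`, any measurable equivalence
`e : G₁ ⧸ C(γ.1) ≃ᵐ (G₁ × G₂) ⧸ C(γ)` with `e(x C(γ.1)) = (x, 1) C(γ)` (it exists iff `γ.2` is central: §2), any measure `m₁` on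
`G₁ ⧸ C(γ.1)` and any `f₁ : G₁ → E`:  `O_γ^{e_* m₁}(f₁ ∘ fst) = O_{γ.1}^{m₁}(f₁)`, i.e.
`orbitalIntegral γ (f₁ ∘ Prod.fst) (map e m₁) = orbitalIntegral γ.1 f₁ m₁` (change of variables ★ `integral_map_equiv`, no integrability
hypothesis; the measure is a parameter of ★ `orbitalIntegral`, σ-algebras arbitrary). [cite: Rogawski1990, L. 4.9.3 p. 56] [cite: Gelbart1975, (10.19) p. 155] -/
theorem orbitalIntegral_prod_comp_fst_map_eq
    (e : G₁ ⧸ Subgroup.centralizer ({γ.1} : Set G₁) ≃ᵐ (G₁ × G₂) ⧸ Subgroup.centralizer ({γ} : Set (G₁ × G₂)))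
    (he : ∀ x : G₁, e (QuotientGroup.mk x) = QuotientGroup.mk (x, 1)) (f₁ : G₁ → E)
    (m₁ : Measure (G₁ ⧸ Subgroup.centralizer ({γ.1} : Set G₁))) :
    orbitalIntegral γ (f₁ ∘ Prod.fst) (Measure.map e m₁) = orbitalIntegral γ.1 f₁ m₁ := by
  rw [orbitalIntegral_eq_integral_descConj, orbitalIntegral_eq_integral_descConj, integral_map_equiv]
  exact integral_congr_ae (Eventually.of_forall fun x => descConj_prod_comp_fst_apply_eq γ e he f₁ x)

/-- **HEAD, measure on the product side as the primary datum**: for every measure `μ` on `(G₁ × G₂) ⧸ C(γ)` (e.g. the member of an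
orbital measure family of `H = G₁ × G₂`), `O_γ^{μ}(f₁ ∘ fst) = O_{γ.1}^{(e⁻¹)_* μ}(f₁)`. [cite: Rogawski1990, L. 4.9.3 p. 56] [cite: Gelbart1975, (10.19) p. 155] -/
theorem orbitalIntegral_prod_comp_fst_eq_map_symm
    (e : G₁ ⧸ Subgroup.centralizer ({γ.1} : Set G₁) ≃ᵐ (G₁ × G₂) ⧸ Subgroup.centralizer ({γ} : Set (G₁ × G₂)))
    (he : ∀ x : G₁, e (QuotientGroup.mk x) = QuotientGroup.mk (x, 1)) (f₁ : G₁ → E)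
    (μ : Measure ((G₁ × G₂) ⧸ Subgroup.centralizer ({γ} : Set (G₁ × G₂)))) :
    orbitalIntegral γ (f₁ ∘ Prod.fst) μ = orbitalIntegral γ.1 f₁ (Measure.map e.symm μ) := by
  rw [← orbitalIntegral_prod_comp_fst_map_eq γ e he f₁ (Measure.map e.symm μ), MeasurableEquiv.map_map_symm]

/-- **The `U(1)`-character bookkeeping** (L. 4.9.3: `ℋ(H, ω_w μ_w⁻¹) = ℋ(U(2)_w) ⊗ ℂ`): for `γ.2` central and a complex factorizable
`Φ = ξ ⊗ χ` (`Φ(a, k) = ξ(a) χ(k)`), `O_γ^{e_* m₁}(Φ) = O_{γ.1}^{m₁}(ξ) · χ(γ.2)`. [cite: Rogawski1990, L. 4.9.3 p. 56] [cite: Gelbart1975, (10.19) p. 155] -/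
theorem orbitalIntegral_prod_tensor_map_eq_of_mem_center (hγ : γ.2 ∈ Subgroup.center G₂)
    (e : G₁ ⧸ Subgroup.centralizer ({γ.1} : Set G₁) ≃ᵐ (G₁ × G₂) ⧸ Subgroup.centralizer ({γ} : Set (G₁ × G₂)))
    (he : ∀ x : G₁, e (QuotientGroup.mk x) = QuotientGroup.mk (x, 1)) {Φ : G₁ × G₂ → ℂ} {ξ : G₁ → ℂ} {χ : G₂ → ℂ}
    (hΦ : ∀ a k, Φ (a, k) = ξ a * χ k) (m₁ : Measure (G₁ ⧸ Subgroup.centralizer ({γ.1} : Set G₁))) :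
    orbitalIntegral γ Φ (Measure.map e m₁) = orbitalIntegral γ.1 ξ m₁ * χ γ.2 := by
  rw [orbitalIntegral_eq_integral_descConj, orbitalIntegral_eq_integral_descConj, integral_map_equiv, ← integral_mul_const]
  exact integral_congr_ae (Eventually.of_forall fun x => descConj_prod_tensor_apply_eq_of_mem_center γ hγ e he hΦ x)

end Orbital

/-! ## §4 Equivariance of `e` and the transport of invariant measures -/

section Invariance

variable {G₁ G₂ : Type*} [Group G₁] [Group G₂] (γ : G₁ × G₂)

/-- **`e` is equivariant**: `e(g.1 • x) = g • e(x)` for every `g ∈ G₁ × G₂` (`γ.2` central: the `G₂`-component acts trivially on the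
classes `(x, 1) C(γ)`). [cite: Folland1995, §2.6] -/
theorem apply_smul_eq_smul_apply_of_mem_center (hγ : γ.2 ∈ Subgroup.center G₂)
    (e : G₁ ⧸ Subgroup.centralizer ({γ.1} : Set G₁) → (G₁ × G₂) ⧸ Subgroup.centralizer ({γ} : Set (G₁ × G₂)))
    (he : ∀ x : G₁, e (QuotientGroup.mk x) = QuotientGroup.mk (x, 1)) (g : G₁ × G₂)
    (x : G₁ ⧸ Subgroup.centralizer ({γ.1} : Set G₁)) : e (g.1 • x) = g • e x := by
  induction x using QuotientGroup.induction_on with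
  | H a =>
    rw [MulAction.Quotient.smul_mk, smul_eq_mul, he, he, MulAction.Quotient.smul_mk, smul_eq_mul,
      ← mk_fst_one_eq_mk_of_mem_center γ hγ (g * (a, 1))]
    rfl

/-- **`e⁻¹` is equivariant** along `G₁ → G₁ × G₂`, `g₁ ↦ (g₁, g₂)`: `π((g₁, g₂) • y) = g₁ • π(y)` for any `π` with `π(p C(γ)) = p.1 C(γ.1)`
(no centrality). [cite: Folland1995, §2.6] -/
theorem symm_apply_smul_eq_smul_symm_apply
    (π : (G₁ × G₂) ⧸ Subgroup.centralizer ({γ} : Set (G₁ × G₂)) → G₁ ⧸ Subgroup.centralizer ({γ.1} : Set G₁))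
    (hπ : ∀ p : G₁ × G₂, π (QuotientGroup.mk p) = QuotientGroup.mk p.1) (g : G₁ × G₂)
    (y : (G₁ × G₂) ⧸ Subgroup.centralizer ({γ} : Set (G₁ × G₂))) : π (g • y) = g.1 • π y := by
  induction y using QuotientGroup.induction_on with
  | H p => rw [MulAction.Quotient.smul_mk, smul_eq_mul, hπ, hπ, MulAction.Quotient.smul_mk, smul_eq_mul, Prod.fst_mul]

variable [TopologicalSpace G₁] [TopologicalSpace G₂] [IsTopologicalGroup G₁] [IsTopologicalGroup G₂]
  [MeasurableSpace (G₁ ⧸ Subgroup.centralizer ({γ.1} : Set G₁))] [BorelSpace (G₁ ⧸ Subgroup.centralizer ({γ.1} : Set G₁))]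
  [MeasurableSpace ((G₁ × G₂) ⧸ Subgroup.centralizer ({γ} : Set (G₁ × G₂)))]
  [BorelSpace ((G₁ × G₂) ⧸ Subgroup.centralizer ({γ} : Set (G₁ × G₂)))]

omit [BorelSpace (G₁ ⧸ Subgroup.centralizer ({γ.1} : Set G₁))] in
/-- **Invariant measures go to invariant measures**: for `γ.2` central, a `G₁`-invariant `m₁` on `G₁ ⧸ C(γ.1)` pushes forward along `e` to a
`G₁ × G₂`-invariant measure on `(G₁ × G₂) ⧸ C(γ)` (so `e_*` of an orbital measure of `G₁` at `γ.1` is an orbital measure of `G₁ × G₂` at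
`γ`). [cite: Folland1995, §2.6] -/
theorem smulInvariantMeasure_map_prod_centralizer_of_mem_center (hγ : γ.2 ∈ Subgroup.center G₂)
    (e : G₁ ⧸ Subgroup.centralizer ({γ.1} : Set G₁) ≃ᵐ (G₁ × G₂) ⧸ Subgroup.centralizer ({γ} : Set (G₁ × G₂)))
    (he : ∀ x : G₁, e (QuotientGroup.mk x) = QuotientGroup.mk (x, 1))
    (m₁ : Measure (G₁ ⧸ Subgroup.centralizer ({γ.1} : Set G₁)))
    [SMulInvariantMeasure G₁ (G₁ ⧸ Subgroup.centralizer ({γ.1} : Set G₁)) m₁] :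
    SMulInvariantMeasure (G₁ × G₂) ((G₁ × G₂) ⧸ Subgroup.centralizer ({γ} : Set (G₁ × G₂))) (Measure.map e m₁) := by
  refine ⟨fun g S hS => ?_⟩
  rw [Measure.map_apply e.measurable hS, Measure.map_apply e.measurable (hS.preimage (measurable_const_smul g))]
  have h1 : (e : G₁ ⧸ Subgroup.centralizer ({γ.1} : Set G₁) → _) ⁻¹' ((fun y => g • y) ⁻¹' S) =
      (fun x => g.1 • x) ⁻¹' ((e : G₁ ⧸ Subgroup.centralizer ({γ.1} : Set G₁) → _) ⁻¹' S) := by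
    ext x
    simp only [Set.mem_preimage, apply_smul_eq_smul_apply_of_mem_center γ hγ e he g x]
  rw [h1]
  exact SMulInvariantMeasure.measure_preimage_smul g.1 (hS.preimage e.measurable)

omit [TopologicalSpace G₂] [IsTopologicalGroup G₂] [BorelSpace ((G₁ × G₂) ⧸ Subgroup.centralizer ({γ} : Set (G₁ × G₂)))] in
/-- **Conversely**: a `G₁ × G₂`-invariant `μ` on `(G₁ × G₂) ⧸ C(γ)` pulls back along `e` (pushes forward along `e⁻¹`) to a `G₁`-invariant
measure on `G₁ ⧸ C(γ.1)` (so `(e⁻¹)_*` of an orbital measure of `H = G₁ × G₂` at `γ` is an orbital measure of `G₁` at `γ.1`).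
[cite: Folland1995, §2.6] -/
theorem smulInvariantMeasure_map_symm_prod_centralizer
    (e : G₁ ⧸ Subgroup.centralizer ({γ.1} : Set G₁) ≃ᵐ (G₁ × G₂) ⧸ Subgroup.centralizer ({γ} : Set (G₁ × G₂)))
    (hes : ∀ p : G₁ × G₂, e.symm (QuotientGroup.mk p) = QuotientGroup.mk p.1)
    (μ : Measure ((G₁ × G₂) ⧸ Subgroup.centralizer ({γ} : Set (G₁ × G₂))))
    [SMulInvariantMeasure (G₁ × G₂) ((G₁ × G₂) ⧸ Subgroup.centralizer ({γ} : Set (G₁ × G₂))) μ] :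
    SMulInvariantMeasure G₁ (G₁ ⧸ Subgroup.centralizer ({γ.1} : Set G₁)) (Measure.map e.symm μ) := by
  refine ⟨fun g₁ S hS => ?_⟩
  rw [Measure.map_apply e.symm.measurable hS,
    Measure.map_apply e.symm.measurable (hS.preimage (measurable_const_smul g₁))]
  have h1 : (e.symm : _ → G₁ ⧸ Subgroup.centralizer ({γ.1} : Set G₁)) ⁻¹' ((fun x => g₁ • x) ⁻¹' S) =
      (fun y => ((g₁, (1 : G₂)) : G₁ × G₂) • y) ⁻¹' ((e.symm : _ → G₁ ⧸ Subgroup.centralizer ({γ.1} : Set G₁)) ⁻¹' S) := by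
    ext y
    simp only [Set.mem_preimage, symm_apply_smul_eq_smul_symm_apply γ e.symm hes ((g₁, (1 : G₂)) : G₁ × G₂) y]
  rw [h1]
  exact SMulInvariantMeasure.measure_preimage_smul ((g₁, (1 : G₂)) : G₁ × G₂) (hS.preimage e.symm.measurable)

end Invariance

/-! ## §5 (U1B.4) The editions for `G₂ = U(J₁) ≤ GL₁` and for the CM local carrier `H_v = U(Φ₂)(L⁺_v) × U(Φ₁)(L⁺_v)` -/

section Editions

open NumberField IsDedekindDomain

variable {S : Type*} [CommRing S] (σ : S →+* S) (J₁ : Matrix (Fin 1) (Fin 1) S) {G₁ : Type*} [Group G₁] [TopologicalSpace G₁]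

/-- **Every element of `U(J₁) ≤ GL₁(S)` is central** (★ `conj_eq_self_fin_one`: `GL₁` is commutative). [cite: Rogawski1990, §4.8 Case (a) p. 53] -/
theorem mem_center_unitaryGroupOfForm_fin_one (b : unitaryGroupOfForm σ J₁) : b ∈ Subgroup.center (unitaryGroupOfForm σ J₁) :=
  Subgroup.mem_center_iff.2 fun g => mul_inv_eq_iff_eq_mul.1 (conj_eq_self_fin_one σ J₁ g b)

/-- **(U1B.4, generic unitary edition)** For ANY group `G₁` (e.g. `U(J₂)_w` in any model) and `G₂ = U(J₁) ≤ GL₁`, at EVERY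
`γ ∈ G₁ × U(J₁)`: the measurable equivalence `e : G₁ ⧸ C(γ.1) ≃ᵐ (G₁ × U(J₁)) ⧸ C(γ)` of §2 exists unconditionally. [cite: Rogawski1990, L. 4.9.3 p. 56] -/
theorem exists_measurableEquiv_quotient_centralizer_unitary_fin_one [TopologicalSpace (unitaryGroupOfForm σ J₁)]
    (γ : G₁ × unitaryGroupOfForm σ J₁) [MeasurableSpace (G₁ ⧸ Subgroup.centralizer ({γ.1} : Set G₁))] [BorelSpace (G₁ ⧸ Subgroup.centralizer ({γ.1} : Set G₁))]
    [MeasurableSpace ((G₁ × unitaryGroupOfForm σ J₁) ⧸ Subgroup.centralizer ({γ} : Set (G₁ × unitaryGroupOfForm σ J₁)))]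
    [BorelSpace ((G₁ × unitaryGroupOfForm σ J₁) ⧸ Subgroup.centralizer ({γ} : Set (G₁ × unitaryGroupOfForm σ J₁)))] :
    ∃ e : G₁ ⧸ Subgroup.centralizer ({γ.1} : Set G₁) ≃ᵐ
        (G₁ × unitaryGroupOfForm σ J₁) ⧸ Subgroup.centralizer ({γ} : Set (G₁ × unitaryGroupOfForm σ J₁)),
      (∀ x : G₁, e (QuotientGroup.mk x) = QuotientGroup.mk (x, 1)) ∧
        ∀ p : G₁ × unitaryGroupOfForm σ J₁, e.symm (QuotientGroup.mk p) = QuotientGroup.mk p.1 :=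
  exists_measurableEquiv_quotient_centralizer_prod_of_mem_center γ (mem_center_unitaryGroupOfForm_fin_one σ J₁ γ.2)

variable (L : Type) [Field L] [NumberField L] [IsCMField L] (Φ₁ : Matrix (Fin 1) (Fin 1) L)
  (v : HeightOneSpectrum (𝓞 ↥(maximalRealSubfield L)))

/-- **Every element of the CM local carrier `U(Φ₁)(L⁺_v) = (cmDatum L 1 Φ₁).Local v` is central** (the carrier is
`U(J₁)(∏_{w∣v} L_w) ≤ GL₁`, ★ `cmDatum_Local`). [cite: Rogawski1990, §4.8 Case (a) p. 53] -/
theorem mem_center_cmLocal_one (b : (UnitaryGroup.cmDatum L 1 Φ₁).Local v) :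
    b ∈ Subgroup.center ((UnitaryGroup.cmDatum L 1 Φ₁).Local v) :=
  mem_center_unitaryGroupOfForm_fin_one (UnitaryGroup.conjLocal L (IsCMField.complexConj L) v)
    ((UnitaryGroup.adelicForm L 1 Φ₁).map (UnitaryGroup.adeleToLocal L v)) b

/-- **(U1B.4, CM edition)** For ANY topological group `G₁` (e.g. `U(Φ₂)(L⁺_v)`, or its transport to a standard model) and the CM local
carrier `G₂ = U(Φ₁)(L⁺_v)`, at EVERY `γ_H ∈ G₁ × U(Φ₁)(L⁺_v)` (in particular at every representative `Quotient.out c` of an orbital measure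
family of `H_v`): the measurable equivalence `e : G₁ ⧸ C(γ_H.1) ≃ᵐ H_v ⧸ C(γ_H)` with `e(x C) = (x, 1) C`, `e⁻¹(p C) = p.1 C` exists.
[cite: Rogawski1990, L. 4.9.3 p. 56] -/
theorem exists_measurableEquiv_quotient_centralizer_cmLocalH (γ : G₁ × (UnitaryGroup.cmDatum L 1 Φ₁).Local v)
    [MeasurableSpace (G₁ ⧸ Subgroup.centralizer ({γ.1} : Set G₁))] [BorelSpace (G₁ ⧸ Subgroup.centralizer ({γ.1} : Set G₁))]
    [MeasurableSpace ((G₁ × (UnitaryGroup.cmDatum L 1 Φ₁).Local v) ⧸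
      Subgroup.centralizer ({γ} : Set (G₁ × (UnitaryGroup.cmDatum L 1 Φ₁).Local v)))]
    [BorelSpace ((G₁ × (UnitaryGroup.cmDatum L 1 Φ₁).Local v) ⧸
      Subgroup.centralizer ({γ} : Set (G₁ × (UnitaryGroup.cmDatum L 1 Φ₁).Local v)))] :
    ∃ e : G₁ ⧸ Subgroup.centralizer ({γ.1} : Set G₁) ≃ᵐ
        (G₁ × (UnitaryGroup.cmDatum L 1 Φ₁).Local v) ⧸ Subgroup.centralizer ({γ} : Set (G₁ × (UnitaryGroup.cmDatum L 1 Φ₁).Local v)),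
      (∀ x : G₁, e (QuotientGroup.mk x) = QuotientGroup.mk (x, 1)) ∧
        ∀ p : G₁ × (UnitaryGroup.cmDatum L 1 Φ₁).Local v, e.symm (QuotientGroup.mk p) = QuotientGroup.mk p.1 :=
  exists_measurableEquiv_quotient_centralizer_prod_of_mem_center γ (mem_center_cmLocal_one L Φ₁ v γ.2)

end Editions

section Family

variable {G₁ G₂ : Type*} [Group G₁] [Group G₂] {E : Type*} [NormedAddCommGroup E] [NormedSpace ℝ E]
  [∀ a : G₁, MeasurableSpace (G₁ ⧸ Subgroup.centralizer ({a} : Set G₁))]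
  [∀ p : G₁ × G₂, MeasurableSpace ((G₁ × G₂) ⧸ Subgroup.centralizer ({p} : Set (G₁ × G₂)))]

/-- **The family form** (the shape a socket consumer meets: `mH : OrbitalMeasureFamily (G₁ × G₂)`, test function `f₁ ∘ Prod.fst`): at a
class `c` of `H = G₁ × G₂` with representative `γ_c = Quotient.out c`, for any measurable equivalence `e` with `e(x C(γ_c.1)) = (x, 1) C(γ_c)`
(§2, §5), `classOrbitalIntegral mH (f₁ ∘ fst) c = O_{γ_c.1}^{(e⁻¹)_* (mH c)}(f₁)`. [cite: Rogawski1990, L. 4.9.3 p. 56] [cite: Gelbart1975, (9.13)] -/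
theorem classOrbitalIntegral_comp_fst_eq_orbitalIntegral_map_symm (mH : OrbitalMeasureFamily (G₁ × G₂)) (c : ConjClasses (G₁ × G₂))
    (e : G₁ ⧸ Subgroup.centralizer ({(Quotient.out c : G₁ × G₂).1} : Set G₁) ≃ᵐ
      (G₁ × G₂) ⧸ Subgroup.centralizer ({(Quotient.out c : G₁ × G₂)} : Set (G₁ × G₂)))
    (he : ∀ x : G₁, e (QuotientGroup.mk x) = QuotientGroup.mk (x, 1)) (f₁ : G₁ → E) :
    classOrbitalIntegral mH (f₁ ∘ Prod.fst) c = orbitalIntegral (Quotient.out c : G₁ × G₂).1 f₁ (Measure.map e.symm (mH c)) := by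
  rw [classOrbitalIntegral_eq]
  exact orbitalIntegral_prod_comp_fst_eq_map_symm (Quotient.out c : G₁ × G₂) e he f₁ (mH c)

end Family

end Summit.HodgeConjecture.HodgeConjecture.R90.S6

end
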